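import Literature.Analysis.FluidPDE.PassiveScalarReleaseBounded
import Literature.Analysis.FluidPDE.PassiveScalarLimitL2tx
import Literature.Analysis.FluidPDE.PassiveScalarWeakLscDissipation
import Literature.Analysis.FluidPDE.PassiveScalarBoundedSlice
import HarnessLib

/-!
# Existence of BOUNDED `L²_t H¹_x` weak passive scalars along `L²` drifts

Analysis/FluidPDE proof file (everything proved; no definitions, no named facts), sixth of the files
discharging `MescoliniPitchoSorella2025_thm24` (Mescolini–Pitcho–Sorella, Ann. Mat. Pura Appl. 204
(2025), Thm. 2.4: "Consider a divergence-free vector field `b ∈ L²((0,T) × T^d; ℝ^d)`, an initial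
datum `ρ_in ∈ L^∞(T^d)`, and a real number `ν > 0`. Then there exists a [unique] weak solution
`ρ^ν ∈ L^∞((0,T) × T^d) ∩ L²((0,T); H¹(T^d))` … such that `‖ρ^ν‖_{L^∞} ≤ ‖ρ_in‖_{L^∞}`").

`exists_isWeakScalarTransportOn_of_abs_le` — for `κ > 0`, `T > 0`, a measurable datum with
`|θ₀| ≤ H` a.e., and a space–time measurable drift `u ∈ L²((0,T) × T^d)` weakly divergence free at
a.e. time, there is a weak solution `θ` of `∂ₜθ + u·∇θ = κΔθ` on `T^d × [0,T)` with datum `θ₀`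
(`Torus.IsWeakScalarTransportOn T κ u θ₀ θ`) with `∫ |θ(t)|² ≤ ‖θ₀‖²_{L²}` for a.e. `t`,
**`|θ(t,x)| ≤ H`** for a.e. `t` and a.e. `x` (maximum principle), and
**`2κ ∫₀ᵀ ‖∇θ‖²_{L²} ≤ ‖θ₀‖²_{L²}`** (`L²_t H¹_x`). The scheme is that of the tree's
`exists_isWeakScalarTransportOn_of_sq_of_abs_le` (`PassiveScalarReleaseBounded`: regularised drifts,
classical solutions, maximum principle, weak-* compactness in `L^∞(0,T;L²)`, identification), with
three changes: the limit drift is only `L²_{t,x}` (identification by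
`IsWeakScalarTransportOn.of_tendsto_of_lintegral_lintegral_sq_lt_top`, `PassiveScalarLimitL2tx`); the
datum is a bounded measurable function, approximated by its mollifications `θ₀ ⋆ kₙ` (smooth,
`|θ₀ ⋆ kₙ| ≤ H`, `→ θ₀` in `L²`); and the dissipation bound passes to the limit by weak lower
semicontinuity (`lintegral_eScalarGradNormSq_le_liminf_of_weakLimit`, `PassiveScalarWeakLscDissipation`).

## References

* G. Mescolini, J. Pitcho, M. Sorella, Ann. Mat. Pura Appl. (4) 204 (2025) 1667–1687, Thm. 2.4,
  proof pp. 1671–1674; Prop. 2.5. [`MescoliniPitchoSorella2025`]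
* R. J. DiPerna, P.-L. Lions, Invent. Math. 98 (1989), Prop. II.1 (regularisation scheme with the
  `L^∞` bound (15)). [`DiPernaLions1989`]
* L. C. Evans, *Partial Differential Equations*, 2nd ed. (2010), §7.1.2 Thm. 3 (energy estimates),
  §7.1.4 Thm. 8 (weak maximum principle). [`Evans2010`]
-/

noncomputable section

open _root_.MeasureTheory _root_.TopologicalSpace _root_.Set _root_.Function _root_.Filter _root_.Metric
open _root_.Topology
open scoped ENNReal NNReal Convolution InnerProductSpace ContDiff

namespace Literature.Analysis.FluidPDE

namespace Torus

variable {d : Type*} [Fintype d]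

section Existence

/-- For a classical solution on `[0,T]`, `eScalarDissipation κ θ 0 T = ofReal (scalarDissipation κ θ 0 T)`
(`κ ≥ 0`; local copy of the tree's `eScalarDissipation_eq_ofReal`, `ReleaseLogBoundSmooth`). [folklore] -/
private theorem eScalarDissipation_eq_ofReal' [DecidableEq d] {κ T : ℝ} {u : ℝ → UnitAddTorus d → EuclideanSpace ℝ d}
    {θ : ℝ → UnitAddTorus d → ℝ} (hκ : 0 ≤ κ) (hT : 0 < T)
    (hθ : IsClassicalScalarTransportOn (Icc 0 T) κ u θ) :
    eScalarDissipation κ θ 0 T = ENNReal.ofReal (scalarDissipation κ θ 0 T) := by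
  have hGc : ContinuousOn (fun t => scalarGradNormSq (θ t)) (Icc 0 T) :=
    hθ.continuousOn_scalarGradNormSq (convex_Icc 0 T) (uniqueDiffOn_Icc hT)
  have hGi : IntegrableOn (fun t => scalarGradNormSq (θ t)) (Ioo 0 T) :=
    hGc.integrableOn_Icc.mono_set Ioo_subset_Icc_self
  have h1 : ∫⁻ t in Ioo 0 T, eScalarGradNormSq (θ t) = ENNReal.ofReal (∫ t in Ioo 0 T, scalarGradNormSq (θ t)) := by
    rw [ofReal_integral_eq_lintegral_ofReal hGi (Eventually.of_forall fun t => scalarGradNormSq_nonneg _)]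
    refine setLIntegral_congr_fun measurableSet_Ioo fun t ht => ?_
    exact eScalarGradNormSq_eq_ofReal_integral (hθ.smooth_scalar.isSmooth_slice (Ioo_subset_Icc_self ht))
  rw [eScalarDissipation, h1, ← ENNReal.ofReal_mul hκ, scalarDissipation, intervalIntegral.integral_of_le hT.le,
    integral_Ioc_eq_integral_Ioo]

/-- **Existence of BOUNDED `L²_t H¹_x` weak solutions of the passive scalar equation along an
`L²((0,T) × T^d)` drift with a bounded datum** (Mescolini–Pitcho–Sorella 2025, Thm. 2.4, existence
with `‖ρ^ν‖_{L^∞} ≤ ‖ρ_in‖_{L^∞}` and the energy bound; DiPerna–Lions 1989, Prop. II.1): for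
`κ > 0`, `T > 0`, a measurable datum `θ₀` with `|θ₀| ≤ H` a.e., and a space–time measurable drift
`u` with `∫₀ᵀ∫ ‖u‖² < ∞`, weakly divergence free at a.e. time, there is a weak solution `θ` of
`∂ₜθ + u·∇θ = κΔθ` on `T^d × [0,T)` with datum `θ₀`, `∫ |θ(t)|² ≤ ‖θ₀‖²_{L²}` for a.e. `t`,
`|θ(t, x)| ≤ H` for a.e. `t` and a.e. `x`, and `2κ ∫₀ᵀ ‖∇θ‖²_{L²} ≤ ‖θ₀‖²_{L²}`.
[cite: MescoliniPitchoSorella2025, Thm. 2.4 p. 1671 (existence), proof pp. 1671–1674] -/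
theorem exists_isWeakScalarTransportOn_of_abs_le [DecidableEq d] {T κ : ℝ} (hκ : 0 < κ) (hT : 0 < T)
    {u : ℝ → UnitAddTorus d → EuclideanSpace ℝ d} {θ₀ : UnitAddTorus d → ℝ}
    (hθ₀m : AEStronglyMeasurable θ₀ volume) {H : ℝ}
    (hθ₀b : ∀ᵐ x ∂(volume : Measure (UnitAddTorus d)), |θ₀ x| ≤ H)
    (hum : AEStronglyMeasurable (FunctionSpaces.Torus.stLift u) (volume.restrict (Ioo 0 T ×ˢ univ)))
    (hu2 : ∫⁻ t in Ioo 0 T, ∫⁻ x, ‖u t x‖ₑ ^ 2 < ⊤)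
    (hdiv : ∀ᵐ t ∂(volume.restrict (Ioo 0 T)), FunctionSpaces.Torus.IsWeaklyDivFree (u t)) :
    ∃ θ : ℝ → UnitAddTorus d → ℝ, IsWeakScalarTransportOn T κ u θ₀ θ ∧
      (∀ᵐ t ∂(volume.restrict (Ioo 0 T)), ∫⁻ x, ‖θ t x‖ₑ ^ 2 ≤ eLpNorm θ₀ 2 volume ^ 2) ∧
      (∀ᵐ t ∂(volume.restrict (Ioo 0 T)), ∀ᵐ x ∂(volume : Measure (UnitAddTorus d)), |θ t x| ≤ H) ∧
      2 * eScalarDissipation κ θ 0 T ≤ ∫⁻ x, ‖θ₀ x‖ₑ ^ 2 := by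
  -- the datum is bounded, hence in `L²`
  have hθ₀top : MemLp θ₀ ⊤ volume :=
    memLp_top_of_bound hθ₀m H (hθ₀b.mono fun x hx => by rw [Real.norm_eq_abs]; exact hx)
  have hθ₀2 : MemLp θ₀ 2 volume := hθ₀top.mono_exponent le_top
  have hθ₀i : Integrable θ₀ volume := hθ₀2.integrable one_le_two
  -- regularised drifts
  obtain ⟨v, hvs, hvdiv, hvlim⟩ := exists_smooth_isDivFree_tendsto_eLpNorm_sub_of_sq hum hu2 hdiv
  -- regularised data: the mollifications of `θ₀`
  obtain ⟨hε, hε', hε0⟩ := molRadius_spec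
  set ε : ℕ → ℝ := fun n => 1 / (4 * ((n : ℝ) + 1)) with hε_def
  have hkS : ∀ n, FunctionSpaces.Torus.IsSmooth (FunctionSpaces.Torus.kernel (d := d) (ε n)) :=
    fun n => FunctionSpaces.Torus.isSmooth_kernel (hε n) (hε' n)
  have hk1 : ∀ n, ∫⁻ y, ‖FunctionSpaces.Torus.kernel (d := d) (ε n) y‖ₑ = 1 :=
    fun n => FunctionSpaces.Torus.lintegral_enorm_kernel (hε n) (hε' n)
  set h : ℕ → UnitAddTorus d → ℝ := fun n => θ₀ ⋆ FunctionSpaces.Torus.kernel (ε n) with hh_def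
  have hh : ∀ n, FunctionSpaces.Torus.IsSmooth (h n) := fun n =>
    FunctionSpaces.Torus.isSmooth_convolution hθ₀i (hkS n)
  have hhH : ∀ n x, |h n x| ≤ H := fun n x =>
    abs_convolution_le_of_ae_abs_le hθ₀b (fun y => FunctionSpaces.Torus.kernel_nonneg (hε n).le y)
      (FunctionSpaces.Torus.integral_kernel (hε n) (hε' n)) (FunctionSpaces.Torus.continuous_kernel (hε n) (hε' n)) x
  have hh2 : ∀ n, MemLp (h n) 2 volume := fun n => (hh n).memLp 2
  have hhle : ∀ n, eLpNorm (h n) 2 volume ≤ eLpNorm θ₀ 2 volume := fun n =>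
    calc eLpNorm (h n) 2 volume ≤ (∫⁻ y, ‖FunctionSpaces.Torus.kernel (ε n) y‖ₑ) * eLpNorm θ₀ 2 volume :=
          FunctionSpaces.Torus.eLpNorm_convolution_le hθ₀m (hkS n).continuous.aestronglyMeasurable one_le_two
      _ = eLpNorm θ₀ 2 volume := by rw [hk1 n, one_mul]
  have hhlim : Tendsto (fun n => eLpNorm (h n - θ₀) 2 volume) atTop (𝓝 0) :=
    FunctionSpaces.Torus.tendsto_eLpNorm_convolution_sub_self hθ₀2
      (fun n y => FunctionSpaces.Torus.kernel_nonneg (hε n).le y)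
      (fun n => FunctionSpaces.Torus.integral_kernel (hε n) (hε' n))
      (fun n => FunctionSpaces.Torus.support_kernel_subset (hε n))
      (fun n => FunctionSpaces.Torus.continuous_kernel (hε n) (hε' n)) hε0
  -- classical solutions of the regularised problems, datum `h n`
  have hcl : ∀ n, ∃ θ : ℝ → UnitAddTorus d → ℝ,
      IsClassicalScalarTransportOn (Icc 0 T) κ (v n) θ ∧ θ 0 = h n := by
    intro n
    obtain ⟨θ, hθ, h0, -⟩ := exists_unique_isClassicalScalarTransportOn_of_forced
      exists_unique_isClassicalScalarTransportForcedOn_holds hκ hT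
      (FunctionSpaces.Torus.isSmoothSpaceTimeOn_of_contDiff (hvs n) _) (fun t _ => hvdiv n t) (hh n)
    exact ⟨θ, hθ, h0⟩
  choose θ hθ hθ0 using hcl
  have hsol : ∀ n, IsWeakScalarTransportOn T κ (v n) (h n) (θ n) := by
    intro n
    have hw := IsClassicalScalarTransportOn.isWeakScalarTransportOn_holds (hθ n) subset_rfl
    rwa [hθ0 n] at hw
  -- the maximum principle `|θₙ| ≤ H` on `[0, T]`
  have hup : ∀ n, ∀ t ∈ Icc 0 T, ∀ x, θ n t x ≤ H := fun n =>
    IsClassicalScalarTransportOn.le_of_le hκ.le (hθ n) fun x => by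
      rw [hθ0 n]; exact (le_abs_self _).trans (hhH n x)
  have hlow : ∀ n, ∀ t ∈ Icc 0 T, ∀ x, -H ≤ θ n t x := fun n =>
    IsClassicalScalarTransportOn.ge_of_ge hκ.le (hθ n) fun x => by
      rw [hθ0 n]; exact (neg_le_neg (hhH n x)).trans (neg_abs_le _)
  -- the a priori bounds `∫ |θₙ(t)|² ≤ ‖θ₀‖₂²` and `2κ ∫₀ᵀ ‖∇θₙ‖² ≤ ‖θ₀‖₂²`
  set C : ℝ≥0 := (eLpNorm θ₀ 2 volume ^ 2).toNNReal with hC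
  have hCeq : (C : ℝ≥0∞) = eLpNorm θ₀ 2 volume ^ 2 :=
    ENNReal.coe_toNNReal (ENNReal.pow_ne_top hθ₀2.eLpNorm_ne_top)
  have hCeq' : (C : ℝ≥0∞) = ∫⁻ x, ‖θ₀ x‖ₑ ^ 2 := by
    rw [hCeq, FunctionSpaces.eLpNorm_two_pow_two_eq_lintegral]
  have hhsq : ∀ n, ENNReal.ofReal (scalarL2Sq (h n)) ≤ C := by
    intro n
    rw [scalarL2Sq, ← lintegral_enorm_sq_eq_ofReal_integral_sq (hh n).continuous,
      ← FunctionSpaces.eLpNorm_two_pow_two_eq_lintegral, hCeq]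
    exact pow_le_pow_left' (hhle n) 2
  have hbd' : ∀ n, ∀ t ∈ Icc 0 T, ∫⁻ x, ‖θ n t x‖ₑ ^ 2 ≤ C := by
    intro n t ht
    have hθc : Continuous (θ n t) := ((hθ n).smooth_scalar.isSmooth_slice ht).continuous
    have hE := IsClassicalScalarTransportOn.scalarL2Sq_add_scalarDissipation_holds (hθ n) ht.1
      (Icc_subset_Icc_right ht.2)
    have hD := scalarDissipation_nonneg hκ.le (θ n) ht.1
    have hle : scalarL2Sq (θ n t) ≤ scalarL2Sq (h n) := by rw [← hθ0 n]; linarith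
    calc ∫⁻ x, ‖θ n t x‖ₑ ^ 2 = ENNReal.ofReal (scalarL2Sq (θ n t)) := lintegral_enorm_sq_eq_ofReal_integral_sq hθc
      _ ≤ ENNReal.ofReal (scalarL2Sq (h n)) := ENNReal.ofReal_le_ofReal hle
      _ ≤ C := hhsq n
  have hbd : ∀ n, ∀ᵐ t ∂(volume.restrict (Ioo 0 T)), ∫⁻ x, ‖θ n t x‖ₑ ^ 2 ≤ C := fun n =>
    (ae_restrict_mem measurableSet_Ioo).mono fun t ht => hbd' n t (Ioo_subset_Icc_self ht)
  have hdis : ∀ n, 2 * eScalarDissipation κ (θ n) 0 T ≤ C := by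
    intro n
    have hE := IsClassicalScalarTransportOn.scalarL2Sq_add_scalarDissipation_holds (hθ n) hT.le subset_rfl
    have hpos : 0 ≤ scalarL2Sq (θ n T) := integral_nonneg fun x => sq_nonneg _
    have hle : 2 * scalarDissipation κ (θ n) 0 T ≤ scalarL2Sq (h n) := by rw [← hθ0 n]; linarith
    rw [eScalarDissipation_eq_ofReal' hκ.le hT (hθ n), ← ENNReal.ofReal_ofNat,
      ← ENNReal.ofReal_mul zero_le_two]
    exact (ENNReal.ofReal_le_ofReal hle).trans (hhsq n)
  -- weak-* compactness and identification of the limit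
  obtain ⟨φ, hφ, W, hWm, hWb, hWlim⟩ :=
    FunctionSpaces.Torus.exists_strictMono_weakLimit_of_lintegral_sq_le (fun n => (hsol n).aestronglyMeasurable) hbd
  have hW : IsWeakScalarTransportOn T κ u θ₀ W :=
    IsWeakScalarTransportOn.of_tendsto_of_lintegral_lintegral_sq_lt_top (fun j => hsol (φ j)) (fun j => hbd (φ j))
      hWm hWb hWlim hum hu2 hdiv (hvlim.comp hφ.tendsto_atTop) hθ₀2 (fun j => hh2 (φ j))
      (hhlim.comp hφ.tendsto_atTop)
  refine ⟨W, hW, ?_, ?_, ?_⟩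
  · filter_upwards [hWb] with t ht
    rwa [hCeq] at ht
  · -- the bound `|W| ≤ H` from both one-sided bounds
    have hθm : ∀ j, AEStronglyMeasurable (FunctionSpaces.Torus.stLift (θ (φ j))) (volume.restrict (Ioo 0 T ×ˢ univ)) :=
      fun j => (hsol (φ j)).aestronglyMeasurable
    have hb1 : ∀ j, ∀ᵐ t ∂(volume.restrict (Ioo 0 T)), ∀ x, θ (φ j) t x ≤ H := fun j =>
      (ae_restrict_mem measurableSet_Ioo).mono fun t ht x => hup (φ j) t (Ioo_subset_Icc_self ht) x
    have hb2 : ∀ j, ∀ᵐ t ∂(volume.restrict (Ioo 0 T)), ∀ x, -H ≤ θ (φ j) t x := fun j =>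
      (ae_restrict_mem measurableSet_Ioo).mono fun t ht x => hlow (φ j) t (Ioo_subset_Icc_self ht) x
    have hupper := ae_le_of_weakLimit hθm hb1 hb2 hWm hWb hWlim
    have hθm' : ∀ j, AEStronglyMeasurable (FunctionSpaces.Torus.stLift (fun t x => -θ (φ j) t x))
        (volume.restrict (Ioo 0 T ×ˢ univ)) := fun j => (hθm j).neg
    have hWm' : AEStronglyMeasurable (FunctionSpaces.Torus.stLift (fun t x => -W t x)) (volume.restrict (Ioo 0 T ×ˢ univ)) :=
      hWm.neg
    have hb1' : ∀ j, ∀ᵐ t ∂(volume.restrict (Ioo 0 T)), ∀ x, (fun t x => -θ (φ j) t x) t x ≤ H := fun j =>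
      (hb2 j).mono fun t ht x => by simpa using neg_le_neg (ht x)
    have hb2' : ∀ j, ∀ᵐ t ∂(volume.restrict (Ioo 0 T)), ∀ x, -H ≤ (fun t x => -θ (φ j) t x) t x := fun j =>
      (hb1 j).mono fun t ht x => by simpa using neg_le_neg (ht x)
    have hWb' : ∀ᵐ t ∂(volume.restrict (Ioo 0 T)), ∫⁻ x, ‖(fun t x => -W t x) t x‖ₑ ^ 2 ≤ C := by
      filter_upwards [hWb] with t ht
      simpa only [enorm_neg] using ht
    have hWlim' : ∀ G : ℝ → UnitAddTorus d → ℝ,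
        AEStronglyMeasurable (FunctionSpaces.Torus.stLift G) (volume.restrict (Ioo 0 T ×ˢ univ)) →
        ∫⁻ t in Ioo 0 T, ∫⁻ x, ‖G t x‖ₑ ^ 2 < ⊤ →
        Tendsto (fun j => ∫ t in Ioo 0 T, ∫ x, (fun t x => -θ (φ j) t x) t x * G t x) atTop
          (𝓝 (∫ t in Ioo 0 T, ∫ x, (fun t x => -W t x) t x * G t x)) := by
      intro G hG1 hG2
      have h1 := (hWlim G hG1 hG2).neg
      have e : ∀ (f : ℝ → UnitAddTorus d → ℝ), -(∫ t in Ioo 0 T, ∫ x, f t x * G t x) =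
          ∫ t in Ioo 0 T, ∫ x, (fun t x => -f t x) t x * G t x := by
        intro f
        rw [← integral_neg]
        refine integral_congr_ae (Eventually.of_forall fun t => ?_)
        dsimp only
        rw [← integral_neg]
        exact integral_congr_ae (Eventually.of_forall fun x => by ring)
      simpa only [e] using h1
    have hlower := ae_le_of_weakLimit hθm' hb1' hb2' hWm' hWb' hWlim'
    filter_upwards [hupper, hlower] with t h1 h2
    filter_upwards [h1, h2] with x hx1 hx2
    have hx2' : -W t x ≤ H := hx2
    exact abs_le.2 ⟨by linarith, hx1⟩
  · -- the dissipation bound by weak lower semicontinuity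
    have hlsc := lintegral_eScalarGradNormSq_le_liminf_of_weakLimit
      (fun j => (hsol (φ j)).aestronglyMeasurable) (fun j => hbd (φ j)) hWm hWb hWlim
    have hdis' : ∀ j, 2 * ENNReal.ofReal κ * ∫⁻ t in Ioo 0 T, eScalarGradNormSq (θ (φ j) t) ≤ C := by
      intro j
      have h1 := hdis (φ j)
      rwa [eScalarDissipation, ← mul_assoc] at h1
    rw [eScalarDissipation, ← mul_assoc, ← hCeq']
    calc 2 * ENNReal.ofReal κ * ∫⁻ t in Ioo 0 T, eScalarGradNormSq (W t)
        ≤ 2 * ENNReal.ofReal κ * liminf (fun j => ∫⁻ t in Ioo 0 T, eScalarGradNormSq (θ (φ j) t)) atTop := by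
          gcongr
      _ ≤ liminf (fun j => 2 * ENNReal.ofReal κ * ∫⁻ t in Ioo 0 T, eScalarGradNormSq (θ (φ j) t)) atTop :=
          ENNReal.mul_liminf_le _ _
      _ ≤ C := liminf_le_of_frequently_le (Eventually.of_forall hdis').frequently

end Existence

end Torus

end Literature.Analysis.FluidPDE
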